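import Literature.NumberTheory.GaloisRepresentations.LubinTateColemanUnitsImageTopologyTwo
import Literature.NumberTheory.GaloisRepresentations.LubinTateColemanCoordCoinvariantDivisionTwo
import HarnessLib

/-!
# The `ε`-part functional `φ_ε : M → Λ` of the Coleman coordinate module is CONTINUOUS, ideals of the compact Noetherian `Λ` are closed, so
# `φ_ε` of anything inside the CLOSURE of the subgroup generated by a family `x` lies in the closed ideal `L·J_ε` — the upper bound
# `φ_ε(Col 𝒞̄) ≤ μ(𝔣)·Λ₀` of de Shalit III §1.4 computed on a closure

De Shalit, *Iwasawa theory of elliptic curves with complex multiplication* (1987), III §1.4: "`C̄_n` the closure of `C_n` … `i(𝒞_𝔣 ⊗̂ 𝐃) = μ(𝔣)Λ₀`"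
— the image of the CLOSURE of the group generated by the elliptic units is computed from the images of the generators; this uses the continuity of
`i` (I §3.4 Corollary, §3.7) and the closedness of ideals of `Λ` (compact Noetherian).  In the tree's series currency (`q = 2`, one prime): the
`ε`-projection `φ_ε = colemanDeltaCoinvFun` (`LubinTateColemanCoordCoinvariantsTwo`) is `Λ`-linear on the free rank-two module `M`; THIS file adds
(0 sorry, no named facts, no definitions):

* §1 generic topology: ★ `continuous_basis_repr_of_compactSpace` — the coordinate functionals of a FINITE basis of a Hausdorff topological module
  over a COMPACT ring (continuous `+`, `•`) are continuous (the inverse of the continuous bijection `R^n → M` from a compact to a Hausdorff space);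
  ★ `LinearMap.continuous_of_basis_of_compactSpace` — hence every `R`-linear functional `M → R` is continuous; `Ideal.isClosed_of_fg` /
  `Ideal.isClosed_of_isNoetherianRing` — finitely generated ideals of a compact Hausdorff topological ring are closed;
  `Submodule.map_le_of_subset_closure` — a continuous linear `φ` with `φ(Z) ⊆ I`, `I` closed, maps every submodule inside `closure Z` into `I`.
* §2 ★★ `continuous_colemanDeltaCoinvFun` — **`φ_ε` is continuous** over any compact Hausdorff topological base `S` with `(ιπ)^n S → 0`
  (e.g. `𝒪_E`, `𝒪_F⟦X⟧`); `continuous_colemanDeltaCoinvFun_intBase` (the two-variable base, instances of `LubinTateColemanUnitsImageTopologyTwo`).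
* §3 ★★★ `map_colemanDeltaCoinvFun_le_of_subset_closure` — if `φ_ε(x c) = (t_{v c} − N c)·L` for every `c` (II §4.12) and the `Λ`-submodule `N′`
  lies inside the CLOSURE of the additive subgroup generated by the `x c`, then **`φ_ε(N′) ≤ (L)·J_ε`** — the hypothesis `hN'L` of the sandwich
  theorems `Summit…PrintCf2RubinValueTwoColemanCoinvariantCharUnits.charIdeal_colemanCoinvariants_eq_of_(units_)sandwich`; with the trivial lower
  bound, `φ_ε(N′) = (L)·J_ε` for every such `N′ ⊇ Λ·span{x c}` (`map_colemanDeltaCoinvFun_eq_of_subset_closure`).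

## References
* E. de Shalit, *Iwasawa theory of elliptic curves with complex multiplication* (1987), Ch. I §3.4 Corollary, §3.7; Ch. III §1.4 (5). [deShalit1987]
* L. C. Washington, *Introduction to Cyclotomic Fields* (1997), §13.2 (compact `Λ`-modules). [Washington1997]
* N. Bourbaki, *General Topology*, Ch. I §9.4 Cor. 2 (continuous bijections from compact to Hausdorff spaces). [BourbakiGT1]
-/

noncomputable section

open Filter Topology
open scoped PowerSeries.WithPiTopology

namespace Literature.NumberTheory.GaloisRepresentations

/-! ### §1. Generic: coordinates of a finite basis over a compact ring are continuous; f.g. ideals are closed -/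

section GenericTopology

/-- ★ **Coordinates in a finite basis are continuous** when the scalar ring is compact and the module Hausdorff with continuous `+` and `c ↦ c • m`:
`c ↦ Σ cᵢ • bᵢ` is a continuous bijection `R^ι → M` from a compact space to a Hausdorff space, hence a homeomorphism. [cite: BourbakiGT1, Ch. I §9.4 Cor. 2] -/
theorem continuous_basis_repr_of_compactSpace {R M ι : Type*} [CommRing R] [TopologicalSpace R] [CompactSpace R] [AddCommGroup M] [Module R M]
    [TopologicalSpace M] [T2Space M] [ContinuousAdd M] [Fintype ι] (b : Module.Basis ι R M) (hsmul : ∀ m : M, Continuous fun c : R => c • m)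
    (i : ι) : Continuous fun m : M => b.repr m i := by
  classical
  have hsymm : Continuous (b.equivFun.symm : (ι → R) → M) := by
    have e : (b.equivFun.symm : (ι → R) → M) = fun c => ∑ j, c j • b j := funext fun c => b.equivFun_symm_apply c
    rw [e]
    exact continuous_finsetSum _ fun j _ => (hsmul (b j)).comp (continuous_apply j)
  let f : (ι → R) ≃ M := b.equivFun.symm.toEquiv
  have hf : Continuous f := hsymm
  have hcont : Continuous f.symm := (hf.homeoOfEquivCompactToT2 (f := f)).symm.continuous
  have e3 : (fun m : M => b.repr m i) = fun m => (f.symm m) i := by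
    funext m; rfl
  rw [e3]
  exact (continuous_apply i).comp hcont

/-- ★ **Every linear functional on a module with a finite basis over a compact topological ring is continuous** (`ℓ m = Σ (repr m)ᵢ · ℓ bᵢ`).
[cite: BourbakiGT1, Ch. I §9.4 Cor. 2] [cite: Washington1997, §13.2] -/
theorem LinearMap.continuous_of_basis_of_compactSpace {R M ι : Type*} [CommRing R] [TopologicalSpace R] [IsTopologicalRing R] [CompactSpace R]
    [AddCommGroup M] [Module R M] [TopologicalSpace M] [T2Space M] [ContinuousAdd M] [Fintype ι] (b : Module.Basis ι R M)
    (hsmul : ∀ m : M, Continuous fun c : R => c • m) (ℓ : M →ₗ[R] R) : Continuous ℓ := by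
  have e : (ℓ : M → R) = fun m => ∑ i, b.repr m i * ℓ (b i) := by
    funext m
    conv_lhs => rw [← b.sum_repr m]
    rw [map_sum]
    exact Finset.sum_congr rfl fun i _ => by rw [map_smul, smul_eq_mul]
  rw [e]
  exact continuous_finsetSum _ fun i _ => (continuous_basis_repr_of_compactSpace b hsmul i).mul continuous_const

/-- **Finitely generated ideals of a compact Hausdorff topological ring are closed** (the image of `R^s` under `c ↦ Σ cᵢ aᵢ`).
[cite: BourbakiGT1, Ch. I §9.4 Cor. 2] [cite: Washington1997, §13.2] -/
theorem Ideal.isClosed_of_fg {R : Type*} [CommRing R] [TopologicalSpace R] [IsTopologicalRing R] [CompactSpace R] [T2Space R] {I : Ideal R}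
    (hI : I.FG) : IsClosed (I : Set R) := by
  classical
  obtain ⟨s, rfl⟩ := hI
  have e : (Ideal.span (s : Set R) : Ideal R) = Submodule.span R (Set.range (fun i : Fin s.card => (s.equivFin.symm i : R))) := by
    congr 1
    ext a
    constructor
    · intro ha
      exact ⟨s.equivFin ⟨a, ha⟩, by simp⟩
    · rintro ⟨i, rfl⟩
      exact (s.equivFin.symm i).2
  rw [e]
  exact isClosed_span_range_of_compactSpace _

/-- **Every ideal of a compact Hausdorff Noetherian topological ring is closed.** [cite: Washington1997, §13.2] -/
theorem Ideal.isClosed_of_isNoetherianRing {R : Type*} [CommRing R] [TopologicalSpace R] [IsTopologicalRing R] [CompactSpace R] [T2Space R]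
    [IsNoetherianRing R] (I : Ideal R) : IsClosed (I : Set R) :=
  Ideal.isClosed_of_fg (IsNoetherian.noetherian I)

/-- **A continuous additive map with `φ(Z) ⊆ I`, `I` closed, maps everything in `closure Z` into `I`.** [cite: BourbakiGT1, Ch. I §2.1 Th. 1] -/
theorem Submodule.map_le_of_subset_closure {R M : Type*} [CommRing R] [TopologicalSpace R] [AddCommGroup M] [Module R M] [TopologicalSpace M]
    (φ : M →ₗ[R] R) (hφ : Continuous φ) {Z : Set M} {I : Ideal R} (hZ : Set.MapsTo φ Z I) (hI : IsClosed (I : Set R))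
    (N' : Submodule R M) (hN' : (N' : Set M) ⊆ closure Z) : N'.map φ ≤ I := by
  rintro _ ⟨y, hy, rfl⟩
  have h := map_mem_closure hφ (hN' hy) hZ
  rwa [hI.closure_eq] at h

/-- The additive subgroup generated by a family is mapped into an ideal containing the images of the family. [cite: Washington1997, §13.2] -/
theorem AddSubgroup.mapsTo_closure_range_of_forall_mem {R M : Type*} [CommRing R] [AddCommGroup M] [Module R M] {I' : Type*}
    (φ : M →ₗ[R] R) (x : I' → M) (I : Ideal R) (hx : ∀ c, φ (x c) ∈ I) :
    Set.MapsTo φ (AddSubgroup.closure (Set.range x) : Set M) I := by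
  intro y hy
  refine AddSubgroup.closure_induction (fun z hz => ?_) ?_ (fun a b _ _ ha hb => ?_) (fun a _ ha => ?_) hy
  · obtain ⟨c, rfl⟩ := hz; exact hx c
  · change φ 0 ∈ I; rw [map_zero]; exact I.zero_mem
  · change φ (a + b) ∈ I; rw [map_add]; exact I.add_mem ha hb
  · change φ (-a) ∈ I; rw [map_neg]; exact I.neg_mem ha

/-- `span {t c · L : c} = (L) · span {t c : c}`. [cite: deShalit1987, Ch. III §1.4 (5)] -/
private theorem span_range_mul_eq_span_singleton_mul' {R : Type*} [CommRing R] {I : Type*} (t : I → R) (L : R) :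
    Ideal.span (Set.range fun c => t c * L) = Ideal.span {L} * Ideal.span (Set.range t) := by
  refine le_antisymm (Ideal.span_le.mpr ?_) (Ideal.mul_le.mpr ?_)
  · rintro _ ⟨c, rfl⟩
    change t c * L ∈ Ideal.span {L} * Ideal.span (Set.range t)
    exact mul_comm L (t c) ▸ Ideal.mul_mem_mul (Ideal.mem_span_singleton_self L) (Ideal.subset_span (Set.mem_range_self c))
  · intro r hr s hs
    obtain ⟨a, rfl⟩ := Ideal.mem_span_singleton'.mp hr
    rw [mul_assoc, mul_comm L s]
    refine Ideal.mul_mem_left _ a ?_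
    refine Submodule.span_induction (p := fun s _ => s * L ∈ Ideal.span (Set.range fun c => t c * L)) ?_ ?_ ?_ ?_ hs
    · rintro _ ⟨c, rfl⟩; exact Ideal.subset_span (Set.mem_range_self c)
    · rw [zero_mul]; exact zero_mem _
    · intro x y _ _ hx hy; rw [add_mul]; exact add_mem hx hy
    · intro a x _ hx; rw [smul_eq_mul, mul_assoc]; exact Ideal.mul_mem_left _ a hx

end GenericTopology

/-! ### §2. `φ_ε` is continuous -/

section Coleman

open GaloisRepresentations.IsNonarchimedeanLocalField LubinTate ValuativeRel

variable {F : Type} [Field F] [ValuativeRel F] [TopologicalSpace F] [IsNonarchimedeanLocalField F]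

attribute [local instance] ltNormUniformSpace ltNormIsUniformAddGroup rk1 nF nE fintypeResidueField

variable {π : 𝒪[F]} (hπ : (valuation F).IsUniformizer (π : F)) (hq : residueFieldCard F = 2)
variable {S : Type*} [CommRing S] (ι : LTCoeff F →+* S) [IsAdicComplete (Ideal.span {ι (LTCoeff.of F π)}) S]
variable [TopologicalSpace S] [IsTopologicalRing S] [CompactSpace S] [T2Space S]
variable (u : (LTCoeff F)ˣ) (hu : LTCoeff.of F π = residueFieldCard F * u) (γ : 𝒪[F]ˣ)
variable (hreg : ∀ x : S, ι (LTCoeff.of F π) * x = 0 → x = 0) (w : 𝒪[F]ˣ) (hγ : (γ : 𝒪[F]) = 1 + π ^ 2 * w)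
variable (ε : PowerSeries S)

/-- ★★ **`φ_ε : M → Λ` is continuous** (coefficientwise topologies) over any compact Hausdorff topological base `S` in which `(ιπ)^n S → 0`
uniformly: `M` is free of rank two (`coordBasisDelta`) and a compact topological `Λ`-module. [cite: deShalit1987, Ch. I §3.4 Corollary, §3.7; Ch. III §1.4]
[cite: Washington1997, §13.2] -/
theorem continuous_colemanDeltaCoinvFun (hp : ∀ U ∈ 𝓝 (0 : S), ∃ n : ℕ, ∀ s : S, ι (LTCoeff.of F π) ^ n * s ∈ U) :
    Continuous (colemanDeltaCoinvFun hπ hq ι u hu γ hreg w hγ ε) := by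
  haveI : CompactSpace (PowerSeries S) := PowerSeries.WithPiTopology.compactSpace _
  haveI : ContinuousSMul (PowerSeries S) (ColemanCoordModule hπ hq ι u hu γ) :=
    TActModule.continuousSMul hp (continuous_twistLinearBase hπ hq ι u γ)
  exact LinearMap.continuous_of_basis_of_compactSpace (coordBasisDelta hπ hq ι u hu γ hreg w hγ)
    (fun m => continuous_id.smul continuous_const) _

end Coleman

section ColemanIntBase

open GaloisRepresentations.IsNonarchimedeanLocalField LubinTate ValuativeRel

variable {F : Type} [Field F] [ValuativeRel F] [TopologicalSpace F] [IsNonarchimedeanLocalField F]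

attribute [local instance] ltNormUniformSpace ltNormIsUniformAddGroup rk1 nF nE fintypeResidueField

variable {π : 𝒪[F]} (hπ : (valuation F).IsUniformizer (π : F)) (hq : residueFieldCard F = 2)
variable (u : (LTCoeff F)ˣ) (hu : LTCoeff.of F π = residueFieldCard F * u) (γ : 𝒪[F]ˣ)
variable [IsAdicComplete (Ideal.span {intBase F (LTCoeff.of F π)}) (PowerSeries 𝒪[F])]
variable (w : 𝒪[F]ˣ) (hγ : (γ : 𝒪[F]) = 1 + π ^ 2 * w) (ε : PowerSeries (PowerSeries 𝒪[F]))

/-- **Two-variable base `𝒪_F⟦X⟧`**: `φ_ε : 𝒪_F⟦X⟧⟦Y⟧ → 𝒪_F⟦X⟧⟦T⟧` is continuous. [cite: deShalit1987, Ch. III §1.4] [cite: Washington1997, §13.2] -/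
theorem continuous_colemanDeltaCoinvFun_intBase :
    Continuous (colemanDeltaCoinvFun hπ hq (intBase F) u hu γ (eq_zero_of_C_pi_mul_eq_zero_integer hπ) w hγ ε) := by
  haveI : CompactSpace (PowerSeries 𝒪[F]) := PowerSeries.WithPiTopology.compactSpace _
  exact continuous_colemanDeltaCoinvFun hπ hq (intBase F) u hu γ _ w hγ ε (exists_pow_mul_mem_nhds_intBase hπ)

end ColemanIntBase

/-! ### §3. The upper bound on a closure: `φ_ε(N′) ≤ (L)·J_ε` for `N′ ⊆ closure ⟨x c⟩` -/

section UpperBound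

open GaloisRepresentations.IsNonarchimedeanLocalField LubinTate ValuativeRel

variable {F : Type} [Field F] [ValuativeRel F] [TopologicalSpace F] [IsNonarchimedeanLocalField F]

attribute [local instance] ltNormUniformSpace ltNormIsUniformAddGroup rk1 nF nE fintypeResidueField

variable {π : 𝒪[F]} (hπ : (valuation F).IsUniformizer (π : F)) (hq : residueFieldCard F = 2)
variable {S : Type*} [CommRing S] (ι : LTCoeff F →+* S) [IsAdicComplete (Ideal.span {ι (LTCoeff.of F π)}) S]
variable [TopologicalSpace S] [IsTopologicalRing S] [CompactSpace S] [T2Space S] [IsNoetherianRing S]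
variable (u : (LTCoeff F)ˣ) (hu : LTCoeff.of F π = residueFieldCard F * u) (γ : 𝒪[F]ˣ)
variable (hreg : ∀ x : S, ι (LTCoeff.of F π) * x = 0 → x = 0) (w : 𝒪[F]ˣ) (hγ : (γ : 𝒪[F]) = 1 + π ^ 2 * w)
variable (ε : PowerSeries S)

/-- ★★★ **The upper bound on a closure** (de Shalit III §1.4 on `C̄`): if `φ_ε(x c) = (t_{v c} − N c)·L` for every `c` and the `Λ`-submodule `N′` lies in
the CLOSURE of the additive subgroup generated by the `x c`, then `φ_ε(N′) ≤ (L)·J_ε` (`J_ε` the ideal of the `t_{v c} − N c`; `φ_ε` continuous, ideals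
of the compact Noetherian `Λ = S⟦T⟧` closed). [cite: deShalit1987, Ch. III §1.4 (5); Ch. II §4.12 (33)] [cite: Washington1997, §13.2] -/
theorem map_colemanDeltaCoinvFun_le_of_subset_closure (hp : ∀ U ∈ 𝓝 (0 : S), ∃ n : ℕ, ∀ s : S, ι (LTCoeff.of F π) ^ n * s ∈ U)
    {I : Type*} (x : I → ColemanCoordModule hπ hq ι u hu γ) (v : I → 𝒪[F]ˣ) (Nm : I → PowerSeries S) (L : PowerSeries S)
    (hL : ∀ c : I, colemanDeltaCoinvFun hπ hq ι u hu γ hreg w hγ ε (x c) =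
      (colemanDeltaCoinvFun hπ hq ι u hu γ hreg w hγ ε (unitTwistₗ hπ hq ι u hu γ (v c) (TActModule.ofPS _ _ 1)) - Nm c) * L)
    (N' : Submodule (PowerSeries S) (ColemanCoordModule hπ hq ι u hu γ))
    (hN' : (N' : Set (ColemanCoordModule hπ hq ι u hu γ)) ⊆ closure (AddSubgroup.closure (Set.range x) : Set (ColemanCoordModule hπ hq ι u hu γ))) :
    N'.map (colemanDeltaCoinvFun hπ hq ι u hu γ hreg w hγ ε) ≤ Ideal.span {L} * Ideal.span (Set.range fun c =>
      colemanDeltaCoinvFun hπ hq ι u hu γ hreg w hγ ε (unitTwistₗ hπ hq ι u hu γ (v c) (TActModule.ofPS _ _ 1)) - Nm c) := by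
  haveI : CompactSpace (PowerSeries S) := PowerSeries.WithPiTopology.compactSpace _
  refine Submodule.map_le_of_subset_closure _ (continuous_colemanDeltaCoinvFun hπ hq ι u hu γ hreg w hγ ε hp)
    (AddSubgroup.mapsTo_closure_range_of_forall_mem _ x _ fun c => ?_) (Ideal.isClosed_of_isNoetherianRing _) N' hN'
  rw [hL c]
  exact Ideal.mul_mem_mul_rev (Ideal.mem_span_singleton_self L) (Ideal.subset_span (Set.mem_range_self (f := fun c =>
    colemanDeltaCoinvFun hπ hq ι u hu γ hreg w hγ ε (unitTwistₗ hπ hq ι u hu γ (v c) (TActModule.ofPS _ _ 1)) - Nm c) c))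

/-- **Hence equality** for every such `N′` containing the `x c`: `φ_ε(N′) = (L)·J_ε` (lower bound `colemanDeltaCoinvFun_map_span_range_eq_span_mul_of_forall`).
[cite: deShalit1987, Ch. III §1.4 (5)] -/
theorem map_colemanDeltaCoinvFun_eq_of_subset_closure (hp : ∀ U ∈ 𝓝 (0 : S), ∃ n : ℕ, ∀ s : S, ι (LTCoeff.of F π) ^ n * s ∈ U)
    {I : Type*} (x : I → ColemanCoordModule hπ hq ι u hu γ) (v : I → 𝒪[F]ˣ) (Nm : I → PowerSeries S) (L : PowerSeries S)
    (hL : ∀ c : I, colemanDeltaCoinvFun hπ hq ι u hu γ hreg w hγ ε (x c) =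
      (colemanDeltaCoinvFun hπ hq ι u hu γ hreg w hγ ε (unitTwistₗ hπ hq ι u hu γ (v c) (TActModule.ofPS _ _ 1)) - Nm c) * L)
    (N' : Submodule (PowerSeries S) (ColemanCoordModule hπ hq ι u hu γ)) (hxN' : ∀ c, x c ∈ N')
    (hN' : (N' : Set (ColemanCoordModule hπ hq ι u hu γ)) ⊆ closure (AddSubgroup.closure (Set.range x) : Set (ColemanCoordModule hπ hq ι u hu γ))) :
    N'.map (colemanDeltaCoinvFun hπ hq ι u hu γ hreg w hγ ε) = Ideal.span {L} * Ideal.span (Set.range fun c =>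
      colemanDeltaCoinvFun hπ hq ι u hu γ hreg w hγ ε (unitTwistₗ hπ hq ι u hu γ (v c) (TActModule.ofPS _ _ 1)) - Nm c) := by
  refine le_antisymm (map_colemanDeltaCoinvFun_le_of_subset_closure hπ hq ι u hu γ hreg w hγ ε hp x v Nm L hL N' hN') ?_
  rw [← span_range_mul_eq_span_singleton_mul', ← colemanDeltaCoinvFun_map_span_range_eq_span_mul_of_forall hπ hq ι u hu γ hreg w hγ ε x v Nm L hL]
  exact Submodule.map_mono (Submodule.span_le.mpr (Set.range_subset_iff.mpr hxN'))

end UpperBound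

end Literature.NumberTheory.GaloisRepresentations
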